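import Mathlib
import Summits.CriticalPhenomena.CardyFormulaZ2.Theorems.CardySelfRefinementDefs
import Summits.CriticalPhenomena.CardyFormulaZ2.Theorems.CardySelfRefinementRussoDriftModel
import Literature.Probability.Percolation.FourArmGarbanShift
import Literature.Probability.Percolation.FourArmGarbanTwoArms
import Literature.Probability.Percolation.FourArmGarbanMonotone
import Literature.Probability.Percolation.FourArmGarbanDocking
import Literature.Probability.Percolation.OrthogonalRevealmentBound
import Literature.Probability.Percolation.SelfRefinementMeasure
import HarnessLib

/-!
# Stub `stub_fourArmAboveOne` of line `far-field-is-a-quarter-turn` (crux `TrivialSectorRate`,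
stmt-CriticalPhenomena-10266): the PERCOLATION-FREE REDUCTION for general path parameter `s`

The tree proves the multi-scale four-arm bound `π₄(m,n) ≤ c (m/n)^{1+ε}` for critical bond-`ℤ²`
through Garban's two-layer scheme (`GarbanScheme`, `fourArm_multiscale_of_scheme`,
`FourArmGarbanAssembly.lean`), whose statement is hard-wired to `bondPercolation (zdGraph 2) half`.
This file re-runs the percolation-free end of that argument ((B.8): summing the separation input
over the blocks, Cauchy–Schwarz with vanishing nondiagonal terms, the revealment/two-arm bound, and
the bounded-ratio / small-inner-radius ranges) for an ARBITRARY probability measure and then for the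
self-refinement laws `M_k(γ s)` along a parameter path, with the four-arm event recentred at an
arbitrary centre (`fourArmTwoClustersAt`) and the revealment controlled by the recentred two-arm
events `openDualArmsAt` (the dependent model `M_k` is only `kℤ²`-translation invariant):

* `real_le_of_schemeData` — measure-generic (B.8) assembly at one pair of scales;
* `real_fourArmTwoClustersAt_mono_left` — `M_k(ρ,c)(fourArmTwoClustersAt c m n)` is monotone in the
  inner radius (lattice configurations carry `M_k`);
* `fourArmAboveOneAlong_of_garbanScheme` — **`FourArmAboveOneAlong k γ` follows from (M3) a uniform
  polynomial two-arm bound at every centre and (M4) a Garban scheme for `M_k(γ s)` at every centre and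
  every pair of scales `n ≥ C₀ m`, `m ≥ m₀`, uniformly in `s`** — the two analytic inputs that remain
  to be proved for the dependent model (registered helper of the stub `stub_fourArmAboveOne`).

Target file:
`Summits/CriticalPhenomena/CardyFormulaZ2/Theorems/CardySelfRefinementTrivialSectorRateStubFourArmAboveOneReduction.lean`.
-/

noncomputable section


namespace Summit.CriticalPhenomena.CardyFormulaZ2.Theorems.CardySelfRefinement.FarField

open Set MeasureTheory
open Literature.Probability.LatticeModels Literature.Probability.Percolation
open Literature.Probability.Percolation.QuadCrossing
open Summit.CriticalPhenomena.CardyFormulaZ2.Theses.CardySelfRefinement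

-- adapted from Literature/Probability/Percolation/FourArmGarbanAssembly.lean (`fourArm_multiscale_of_scheme`,
-- scheme branch), with the measure, the target event and the two-arm bound abstracted
/-- **Garban's (B.8) assembly for an arbitrary probability measure** (Schramm–Smirnov 2011, App. B,
end of the proof of Lemma B.1).  At scales `1 ≤ m ≤ n`, given blocks `J` with
`#J ≥ K₁ (n/m)²`, a variable `X` with `E[X²] ≤ 1`, bits `|C_j| ≤ 1` with vanishing nondiagonal
terms `E[C_i Y_i C_j Y_j] = 0`, the separation input `μ(E) ≤ K₂ E[X C_j ; V_j]` for every block and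
the revealment bound `μ(V_j) ≤ K₃ c' (K₄ m/n)^{2ε}`, one has
`μ(E) ≤ (K₂ √(K₃ c') K₄^ε / √K₁) (m/n)^{1+ε}`. -/
theorem real_le_of_schemeData (μ : Measure (BondConfig (Site 2))) [IsProbabilityMeasure μ]
    {ε K₁ K₂ K₃ K₄ c' : ℝ} (hK₁ : 0 < K₁) (hK₂ : 0 ≤ K₂) (hK₃ : 0 ≤ K₃) (hK₄ : 0 ≤ K₄)
    (hc' : 0 < c') {m n : ℕ} (hm : 1 ≤ m) (hmn : m ≤ n) (E : Set (BondConfig (Site 2)))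
    (J : Finset (Site 2)) (X : BondConfig (Site 2) → ℝ) (C : Site 2 → BondConfig (Site 2) → ℝ)
    (V : Site 2 → Set (BondConfig (Site 2)))
    (hcard : K₁ * ((n : ℝ) / m) ^ 2 ≤ (J.card : ℝ)) (hX : MemLp X 2 μ)
    (hX2 : ∫ ω, X ω ^ 2 ∂μ ≤ 1) (hCm : ∀ j ∈ J, AEStronglyMeasurable (C j) μ)
    (hC1 : ∀ j ∈ J, ∀ ω, |C j ω| ≤ 1) (hVm : ∀ j ∈ J, MeasurableSet (V j))
    (horth : ∀ i ∈ J, ∀ j ∈ J, i ≠ j →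
      ∫ ω, (V i).indicator (C i) ω * (V j).indicator (C j) ω ∂μ = 0)
    (hsep : ∀ j ∈ J, μ.real E ≤ K₂ * ∫ ω in V j, X ω * C j ω ∂μ)
    (hrev : ∀ j ∈ J, μ.real (V j) ≤ K₃ * (c' * (K₄ * ((m : ℝ) / n)) ^ (2 * ε))) :
    μ.real E ≤ K₂ * Real.sqrt (K₃ * c') * K₄ ^ ε / Real.sqrt K₁ * ((m : ℝ) / n) ^ (1 + ε) := by
  set q : ℝ := (m : ℝ) / n with hq
  have hm0 : (0 : ℝ) < m := by exact_mod_cast hm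
  have hn0 : (0 : ℝ) < n := by exact_mod_cast (hm.trans hmn)
  have hq0 : 0 < q := div_pos hm0 hn0
  set c₁ : ℝ := K₂ * Real.sqrt (K₃ * c') * K₄ ^ ε / Real.sqrt K₁ with hc₁
  set N : ℝ := (J.card : ℝ) with hN
  set P4 : ℝ := μ.real E with hP4
  have hNK : K₁ * ((n : ℝ) / m) ^ 2 ≤ N := hcard
  have hNpos : 0 < N := lt_of_lt_of_le (by positivity) hNK
  -- (1) summing `sep` over the blocks
  have h1 : N * P4 ≤ K₂ * ∑ j ∈ J, ∫ ω in V j, X ω * C j ω ∂μ := by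
    have := Finset.sum_le_sum hsep
    rwa [Finset.sum_const, nsmul_eq_mul, ← Finset.mul_sum] at this
  -- (2) Cauchy–Schwarz with vanishing nondiagonal terms (B.8)
  have h2 : ∑ j ∈ J, ∫ ω in V j, X ω * C j ω ∂μ ≤ Real.sqrt (∑ j ∈ J, μ.real (V j)) := by
    have h := finsetSum_integral_mul_indicator_le_of_orthogonal J zero_le_one hX hCm hC1 hVm horth
    have hX' : Real.sqrt (∫ ω, X ω ^ 2 ∂μ) ≤ 1 := by
      rw [← Real.sqrt_one]; exact Real.sqrt_le_sqrt hX2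
    rw [one_mul] at h
    exact h.trans (mul_le_of_le_one_left (Real.sqrt_nonneg _) hX')
  -- (3) revealment and the two-arm bound
  set B : ℝ := K₃ * c' * (K₄ * q) ^ (2 * ε) with hB
  have hB0 : 0 ≤ B := by positivity
  have h3 : ∑ j ∈ J, μ.real (V j) ≤ N * B := by
    have hj : ∀ j ∈ J, μ.real (V j) ≤ B := fun j hj => (hrev j hj).trans_eq (by rw [hB]; ring)
    have := Finset.sum_le_sum hj
    rwa [Finset.sum_const, nsmul_eq_mul] at this
  -- (4) `N · P4 ≤ K₂ √(N B)`, hence `√N · P4 ≤ K₂ √B`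
  have h4 : N * P4 ≤ K₂ * Real.sqrt (N * B) :=
    h1.trans (mul_le_mul_of_nonneg_left (h2.trans (Real.sqrt_le_sqrt h3)) hK₂)
  have hsN : 0 < Real.sqrt N := Real.sqrt_pos.2 hNpos
  have h5 : Real.sqrt N * P4 ≤ K₂ * Real.sqrt B := by
    have h4' : Real.sqrt N * (Real.sqrt N * P4) ≤ Real.sqrt N * (K₂ * Real.sqrt B) := by
      calc Real.sqrt N * (Real.sqrt N * P4) = N * P4 := by
            rw [← mul_assoc, Real.mul_self_sqrt hNpos.le]
        _ ≤ K₂ * Real.sqrt (N * B) := h4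
        _ = Real.sqrt N * (K₂ * Real.sqrt B) := by rw [Real.sqrt_mul hNpos.le]; ring
    exact le_of_mul_le_mul_left h4' hsN
  -- (5) `√N ≥ √K₁ · n/m`
  have h6 : Real.sqrt K₁ * ((n : ℝ) / m) ≤ Real.sqrt N := by
    have := Real.sqrt_le_sqrt hNK
    rwa [Real.sqrt_mul hK₁.le, Real.sqrt_sq (by positivity)] at this
  have h7 : Real.sqrt K₁ * ((n : ℝ) / m) * P4 ≤ K₂ * Real.sqrt B :=
    (mul_le_mul_of_nonneg_right h6 measureReal_nonneg).trans h5
  -- (6) `√B = √(K₃ c') (K₄ q)^ε`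
  have hsqB : Real.sqrt B = Real.sqrt (K₃ * c') * (K₄ ^ ε * q ^ ε) := by
    rw [hB, Real.sqrt_mul (by positivity), Real.sqrt_eq_rpow ((K₄ * q) ^ (2 * ε)),
      ← Real.rpow_mul (by positivity), ← Real.mul_rpow hK₄ hq0.le]
    congr 1
    ring_nf
  -- (7) solve for `P4`
  have hpos : 0 < Real.sqrt K₁ * ((n : ℝ) / m) := by positivity
  have h8 : P4 ≤ K₂ * Real.sqrt B / (Real.sqrt K₁ * ((n : ℝ) / m)) := by
    rw [le_div_iff₀ hpos]
    calc P4 * (Real.sqrt K₁ * ((n : ℝ) / m)) = Real.sqrt K₁ * ((n : ℝ) / m) * P4 := by ring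
      _ ≤ K₂ * Real.sqrt B := h7
  have h9 : K₂ * Real.sqrt B / (Real.sqrt K₁ * ((n : ℝ) / m)) = c₁ * q ^ (1 + ε) := by
    rw [hsqB, hc₁, Real.rpow_add hq0, Real.rpow_one, hq]
    have hK₁' : Real.sqrt K₁ ≠ 0 := (Real.sqrt_pos.2 hK₁).ne'
    field_simp
  exact h8.trans_eq h9

/-- **The recentred four-arm probability under `M_k(ρ,c)` is monotone in the inner radius**:
`M_k(ρ,c)(fourArmTwoClustersAt c m n) ≤ M_k(ρ,c)(fourArmTwoClustersAt c m' n)` for `m ≤ m' ≤ n`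
(`M_k` is carried by lattice configurations, `selfRefinementMeasure_ae_subset_edgeSet`; translate to
the origin by `fourArmTwoClustersAt_eq_preimage` and use `mem_fourArmTwoClusters_mono`). -/
theorem real_fourArmTwoClustersAt_mono_left (k : ℕ) (ρ c₀ : ℝ) (c : Site 2) {m m' n : ℕ}
    (hmm' : m ≤ m') (hm'n : m' ≤ n) :
    (M k ρ c₀).real (fourArmTwoClustersAt c m n) ≤ (M k ρ c₀).real (fourArmTwoClustersAt c m' n) := by
  refine ENNReal.toReal_mono (measure_ne_top _ _) (measure_mono_ae ?_)
  have hae : ∀ᵐ ω ∂(M k ρ c₀), ω ⊆ (zdGraph 2).edgeSet := selfRefinementMeasure_ae_subset_edgeSet k ρ c₀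
  filter_upwards [hae] with ω hω h4
  show ω ∈ fourArmTwoClustersAt c m' n
  have h4' : ω ∈ fourArmTwoClustersAt c m n := h4
  rw [fourArmTwoClustersAt_eq_preimage, mem_preimage] at h4' ⊢
  exact mem_fourArmTwoClusters_mono hmm' hm'n le_rfl (relabel_shift_subset_edgeSet (-c) hω) h4'

/-- **Four arms above one along a path, from the two analytic inputs of Garban's scheme for the
dependent model** (registered helper of the stub `stub_fourArmAboveOne`).  If along the path
(M3) the recentred two-arm events decay polynomially, `M_k(γ s)(openDualArmsAt c m n) ≤ c' (m/n)^a`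
for `m₀ ≤ m ≤ n`, uniformly in `s` and `c`, and (M4) at every centre `c` and every pair of scales
`n ≥ C₀ m`, `m ≥ m₀` there are blocks `J` (`#J ≥ K₁ (n/m)²`), a variable `X` (`E[X²] ≤ 1`), bits
`|C_j| ≤ 1` and measurable revealment events `V_j` with vanishing nondiagonal terms, the separation
input `M_k(γ s)(fourArmTwoClustersAt c m n) ≤ K₂ E[X C_j ; V_j]` and the revealment bound
`M_k(γ s)(V_j) ≤ K₃ M_k(γ s)(openDualArmsAt c'_j a b)` for radii `m ≤ a ≤ b`, `a/b ≤ K₄ m/n`, with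
constants uniform in `s, c, m, n` — then `FourArmAboveOneAlong k γ` (exponent `1 + a/2`).  The
ranges `n < C₀ m₁ m` and `r < m₁` are absorbed by `ratio_bound_of_large_ratio` and the monotonicity
`real_fourArmTwoClustersAt_mono_left`. -/
theorem fourArmAboveOneAlong_of_garbanScheme (k : ℕ) (γ : unitInterval → ℝ × ℝ)
    (h₂ : ∃ c' a : ℝ, 0 < c' ∧ 0 < a ∧ ∃ m₀ : ℕ, ∀ (s : unitInterval) (c : Site 2) (m n : ℕ),
      m₀ ≤ m → m ≤ n →
        (M k (γ s).1 (γ s).2).real (openDualArmsAt c m n) ≤ c' * ((m : ℝ) / n) ^ a)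
    (hS : ∃ (K₁ K₂ K₃ K₄ : ℝ) (C₀ m₀ : ℕ), 0 < K₁ ∧ 0 ≤ K₂ ∧ 0 ≤ K₃ ∧ 0 ≤ K₄ ∧ 1 ≤ C₀ ∧
      ∀ (s : unitInterval) (c : Site 2) (m n : ℕ), m₀ ≤ m → C₀ * m ≤ n →
        ∃ (J : Finset (Site 2)) (X : BondConfig (Site 2) → ℝ) (C : Site 2 → BondConfig (Site 2) → ℝ)
          (V : Site 2 → Set (BondConfig (Site 2))) (a b : ℕ),
          K₁ * ((n : ℝ) / m) ^ 2 ≤ (J.card : ℝ) ∧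
          MemLp X 2 (M k (γ s).1 (γ s).2) ∧
          ∫ ω, X ω ^ 2 ∂(M k (γ s).1 (γ s).2) ≤ 1 ∧
          (∀ j ∈ J, AEStronglyMeasurable (C j) (M k (γ s).1 (γ s).2)) ∧
          (∀ j ∈ J, ∀ ω, |C j ω| ≤ 1) ∧
          (∀ j ∈ J, MeasurableSet (V j)) ∧
          (∀ i ∈ J, ∀ j ∈ J, i ≠ j →
            ∫ ω, (V i).indicator (C i) ω * (V j).indicator (C j) ω ∂(M k (γ s).1 (γ s).2) = 0) ∧
          (∀ j ∈ J, (M k (γ s).1 (γ s).2).real (fourArmTwoClustersAt c m n) ≤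
            K₂ * ∫ ω in V j, X ω * C j ω ∂(M k (γ s).1 (γ s).2)) ∧
          m ≤ a ∧ a ≤ b ∧ (a : ℝ) / b ≤ K₄ * m / n ∧
          (∀ j ∈ J, ∃ c' : Site 2, (M k (γ s).1 (γ s).2).real (V j) ≤
            K₃ * (M k (γ s).1 (γ s).2).real (openDualArmsAt c' a b))) :
    FourArmAboveOneAlong k γ := by
  obtain ⟨c', a₂, hc', ha₂, m₃, h₂⟩ := h₂
  obtain ⟨K₁, K₂, K₃, K₄, C₀, m₄, hK₁, hK₂, hK₃, hK₄, hC₀, hS⟩ := hS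
  set ε : ℝ := a₂ / 2 with hεdef
  have hε : 0 < ε := by positivity
  have h2ε : 2 * ε = a₂ := by rw [hεdef]; ring
  -- the threshold on the inner radius
  set m₁ : ℕ := max (max m₃ m₄) 1 with hm₁def
  have hm₁3 : m₃ ≤ m₁ := (le_max_left _ _).trans (le_max_left _ _)
  have hm₁4 : m₄ ≤ m₁ := (le_max_right _ _).trans (le_max_left _ _)
  have hm₁1 : 1 ≤ m₁ := le_max_right _ _
  have hm₁0 : (0 : ℝ) < m₁ := by exact_mod_cast hm₁1
  set c₁ : ℝ := K₂ * Real.sqrt (K₃ * c') * K₄ ^ ε / Real.sqrt K₁ with hc₁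
  have hc₁0 : 0 ≤ c₁ := by positivity
  -- Step 1: the scheme regime `m₁ ≤ m`, `C₀ m ≤ n`
  have hcore : ∀ (s : unitInterval) (c : Site 2) (m n : ℕ), m₁ ≤ m → C₀ * m ≤ n →
      (M k (γ s).1 (γ s).2).real (fourArmTwoClustersAt c m n) ≤ c₁ * ((m : ℝ) / n) ^ (1 + ε) := by
    intro s c m n hm hn
    haveI := isProbabilityMeasure_M k (γ s).1 (γ s).2
    have hm1 : 1 ≤ m := hm₁1.trans hm
    have hmn : m ≤ n := le_trans (Nat.le_mul_of_pos_left m (by omega)) hn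
    obtain ⟨J, X, C, V, a, b, hcard, hX, hX2, hCm, hC1, hVm, horth, hsep, hma, hab, hratio, hrev⟩ :=
      hS s c m n (hm₁4.trans hm) hn
    have hm0 : (0 : ℝ) < m := by exact_mod_cast hm1
    have hn0 : (0 : ℝ) < n := by exact_mod_cast (hm1.trans hmn)
    have hrev' : ∀ j ∈ J, (M k (γ s).1 (γ s).2).real (V j) ≤
        K₃ * (c' * (K₄ * ((m : ℝ) / n)) ^ (2 * ε)) := by
      intro j hj
      obtain ⟨c'', hc''⟩ := hrev j hj
      have htwo := h₂ s c'' a b (hm₁3.trans (hm.trans hma)) hab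
      have hab0 : (0 : ℝ) ≤ a / b := by positivity
      have hratio' : (a : ℝ) / b ≤ K₄ * ((m : ℝ) / n) := by rwa [mul_div_assoc] at hratio
      have hpow : ((a : ℝ) / b) ^ a₂ ≤ (K₄ * ((m : ℝ) / n)) ^ (2 * ε) := by
        rw [h2ε]; exact Real.rpow_le_rpow hab0 hratio' ha₂.le
      exact hc''.trans (mul_le_mul_of_nonneg_left
        (htwo.trans (mul_le_mul_of_nonneg_left hpow hc'.le)) hK₃)
    exact real_le_of_schemeData (M k (γ s).1 (γ s).2) hK₁ hK₂ hK₃ hK₄ hc' hm1 hmn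
      (fourArmTwoClustersAt c m n) J X C V hcard hX hX2 hCm hC1 hVm horth hsep hrev'
  -- Step 2: large ratio `C₀ m₁ m ≤ n` for every `1 ≤ m` (small inner radii by monotonicity)
  set c₂ : ℝ := c₁ * (m₁ : ℝ) ^ (1 + ε) with hc₂
  have hlarge : ∀ (s : unitInterval) (c : Site 2) (m n : ℕ), 1 ≤ m → ((C₀ * m₁ : ℕ) : ℝ) * m ≤ n →
      (M k (γ s).1 (γ s).2).real (fourArmTwoClustersAt c m n) ≤ c₂ * ((m : ℝ) / n) ^ (1 + ε) := by
    intro s c m n hm hn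
    have hn' : C₀ * m₁ * m ≤ n := by exact_mod_cast hn
    have hm0 : (0 : ℝ) < m := by exact_mod_cast hm
    have hK0 : (0 : ℝ) < ((C₀ * m₁ : ℕ) : ℝ) := by exact_mod_cast Nat.mul_pos (by omega) (by omega)
    have hn0 : (0 : ℝ) < n := lt_of_lt_of_le (mul_pos hK0 hm0) hn
    have hq0 : 0 < (m : ℝ) / n := div_pos hm0 hn0
    have hpow1 : ((m : ℝ) / n) ^ (1 + ε) ≤ (m₁ : ℝ) ^ (1 + ε) * ((m : ℝ) / n) ^ (1 + ε) :=
      le_mul_of_one_le_left (Real.rpow_nonneg hq0.le _)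
        (Real.one_le_rpow (by exact_mod_cast hm₁1) (by positivity))
    by_cases hmm₁ : m₁ ≤ m
    · have hC₀m : C₀ * m ≤ n := le_trans (Nat.mul_le_mul_right m (Nat.le_mul_of_pos_right C₀ (by omega))) hn'
      calc (M k (γ s).1 (γ s).2).real (fourArmTwoClustersAt c m n) ≤ c₁ * ((m : ℝ) / n) ^ (1 + ε) :=
            hcore s c m n hmm₁ hC₀m
        _ ≤ c₁ * ((m₁ : ℝ) ^ (1 + ε) * ((m : ℝ) / n) ^ (1 + ε)) := mul_le_mul_of_nonneg_left hpow1 hc₁0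
        _ = c₂ * ((m : ℝ) / n) ^ (1 + ε) := by rw [hc₂]; ring
    · have hlt : m ≤ m₁ := (not_le.1 hmm₁).le
      have hm₁n : C₀ * m₁ ≤ n := le_trans (Nat.le_mul_of_pos_right _ (by omega)) hn'
      have hm₁n' : m₁ ≤ n := le_trans (Nat.le_mul_of_pos_left m₁ (by omega)) hm₁n
      have hmono := real_fourArmTwoClustersAt_mono_left k (γ s).1 (γ s).2 c hlt hm₁n'
      have hq₁ : ((m₁ : ℝ) / n) ^ (1 + ε) ≤ (m₁ : ℝ) ^ (1 + ε) * ((m : ℝ) / n) ^ (1 + ε) := by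
        rw [← Real.mul_rpow hm₁0.le hq0.le]
        refine Real.rpow_le_rpow (by positivity) ?_ (by positivity)
        rw [mul_div_assoc', div_le_div_iff_of_pos_right hn0]
        have : (1 : ℝ) ≤ m := by exact_mod_cast hm
        nlinarith
      calc (M k (γ s).1 (γ s).2).real (fourArmTwoClustersAt c m n)
          ≤ (M k (γ s).1 (γ s).2).real (fourArmTwoClustersAt c m₁ n) := hmono
        _ ≤ c₁ * ((m₁ : ℝ) / n) ^ (1 + ε) := hcore s c m₁ n le_rfl hm₁n
        _ ≤ c₁ * ((m₁ : ℝ) ^ (1 + ε) * ((m : ℝ) / n) ^ (1 + ε)) := mul_le_mul_of_nonneg_left hq₁ hc₁0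
        _ = c₂ * ((m : ℝ) / n) ^ (1 + ε) := by rw [hc₂]; ring
  -- Step 3: all `1 ≤ r ≤ R` (bounded ratio is trivial: `ratio_bound_of_large_ratio`)
  have hK : (1 : ℝ) ≤ ((C₀ * m₁ : ℕ) : ℝ) := by
    exact_mod_cast (show 1 ≤ C₀ * m₁ from le_trans hC₀ (Nat.le_mul_of_pos_right C₀ (by omega)))
  refine ⟨ε, max c₂ ((((C₀ * m₁ : ℕ) : ℝ)) ^ (1 + ε)), hε, fun s c r R hr hrR => ?_⟩
  haveI := isProbabilityMeasure_M k (γ s).1 (γ s).2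
  exact ratio_bound_of_large_ratio (f := fun m n => (M k (γ s).1 (γ s).2).real (fourArmTwoClustersAt c m n))
    (by positivity) hK (fun _ _ => measureReal_le_one) (fun m n hm hn => hlarge s c m n hm hn) r R hr hrR

end Summit.CriticalPhenomena.CardyFormulaZ2.Theorems.CardySelfRefinement.FarField

end
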